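import Summits.ResolutionOfSingularities.ResolutionOfSingularities.Theorems.HilbertSamuelEliminationSigmaMaxModificationsCorridor3CPFramePropagationAlong
import HarnessLib

/-!
# [OURS · L1 W4.2] D18 (i) ALONG THE CHAIN: CP frames with `δ ≥ 1` over complete bases exist at EVERY stage reached by canonical near steps
# from a maximal origin — modulo ONE binder, the ADAPTED LEGAL READING of each canonical centre in some CP frame of its stage
# (cell res-hironaka, LADDER-RESOLUTION rung L; slot W4.2, crux chain w42 `SigmaMaxModificationsCorridor3` stmt-ResolutionOfSingularities-19249;
# `--supports stmt-ResolutionOfSingularities-19249 --as helper`; hand res-D-brk-3 (gen 6), D18 (iv) = the `Finset`-indexed form of G6 (c)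
# `IsCPFrame.exists_isCPFrame_blowup_of_map_stalkIdeal_eq` (the σ-corner model's legality `∀ i ∈ Icc 1 m, f_{i,X} ∈ I_T^i`, res-type-064's
# `isPermissible_boardOf_iff_forall_mem_pow`) + induction over `Reaches`)

SCHEME-SIDE BOOKKEEPING (universe `0`), 0 `def`s, every declaration PROVED; OURS; NOT a statement of Hironaka's manuscript [Hironaka2017] nor of
[CossartJannsenSaito2020]/[CossartPiltant2019]. AI-written, weaker than expert review.

* `IsCPFrame.exists_isCPFrame_blowup_of_map_stalkIdeal_eq_finset` — G6 (c) with the centre read as `V(X, u_j : j ∈ T)` for a subset `T` of the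
  frame's OWN r.s.p. `u` and the legality `∀ i ∈ Icc 1 m, h.coeff (m − i) ∈ (u_T)^i` (CP's `δ_T ≥ 1`; the σ-corner model's `IsPermissible
  (boardOf u h) T` by `isPermissible_boardOf_iff_forall_mem_pow`): the frame propagates to every near point over `x_n` of the blow-up of `C`.
* **`exists_isCPFrame_of_reaches`** — INVARIANT `H(s)`: «`s` carries a CP frame `(R, u, h, φ)` (res-type-067's `IsCPFrame`) over a COMPLETE base
  with `coeff_i h ∈ 𝔪_R^{m−i}` (`δ ≥ 1`)». HYPOTHESES: maximal origin, functional admissible oracle (064's HS-stability inputs); `H(init)`; and the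
  binder `hread` — at every reached stage and every canonical centre `(C, P')` there, SOME CP frame of the stage reads `C` as `V(X, u_T)` LEGALLY
  (CP 2019 Prop. 2.7, first paragraph: `I(W) = (u_J)` for an r.s.p. adapted to the boundary, re-preparation `Z = X − θ` with `θ ∈ (u_J)` —
  res-lit-4's `exists_mem_span_isMinimal_comp_X_add_C_of_span_eq_maximalIdeal` —, and `δ(y) ≥ 1` from `𝒴 ⊂ Sing_m`, in the tree Bennett's
  criterion `Literature…NormalFlatnessCriterion`; NOT proved here — the σ-layer's / a separate item). CONCLUSION: `H(s)` at every stage `s`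
  with `Reaches R₀ 3 ν (init X₀ x) s`. Proof: induction on `Relation.ReflTransGen`, step = the first theorem.

References: CP 2019 Prop. 2.6–2.7 [CossartPiltant2019]; CJS LNM 2270 Thm. 2.3, §2.2 [CossartJannsenSaito2020].
-/

noncomputable section

set_option linter.dupNamespace false

open CategoryTheory AlgebraicGeometry TopologicalSpace IsLocalRing Polynomial
open Literature.AlgebraicGeometry.Resolution
open Summit.ResolutionOfSingularities.ResolutionOfSingularities.Theorems.CampaignW42

namespace Summit.ResolutionOfSingularities.ResolutionOfSingularities.Theorems.SigmaMaxModificationsCorridor3.Moving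

/-- [OURS · L1 W4.2] **D18 (i), `Finset` form: a CP frame reading the centre as `V(X, u_T)` legally (`f_{i,X} ∈ (u_T)^i`) propagates to every
near point of the blow-up.** [cite: CossartPiltant2019, Prop. 2.6–2.7 (arXiv v1 pp. 13–14)] [cite: CossartJannsenSaito2020, Thm. 2.3 and §2.2] -/
theorem IsCPFrame.exists_isCPFrame_blowup_of_map_stalkIdeal_eq_finset {p : ℕ} {R₀ : ∀ S : Scheme.{0}, CentreSeq S → Prop}
    (hRf : OracleFunctional R₀) (hRa : OracleAdmissible R₀) {ν : ℕ → ℕ} {X₀ : Scheme.{0}} [IsLocallyNoetherian X₀] {x : X₀}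
    (hX : IsMaximalOrigin p 3 ν X₀ x) {s : MarkedStage.{0}} (hs : Reaches R₀ 3 ν (MarkedStage.init X₀ x) s)
    (C : s.W.IdealSheafData) (P' : Option (Pending (blowup C))) (hln' : IsLocallyNoetherian (blowup C)) (x' : ↥(blowup C))
    (hcs : IsCanonicalStep R₀ 3 ν s.L s.P C P') (hx' : (blowup.π C).base x' = s.pt) (hcl : IsClosed ({x'} : Set ↥(blowup C)))
    (hstr : x' ∈ Scheme.hsStratum (blowup C) 3 ν)
    {R : Type} [CommRing R] {u : Fin 3 → R} {h : R[X]}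
    {φ : (s.W.presheaf.stalk s.pt : Type) →+* R[X] ⧸ Ideal.span {h}} (hF : IsCPFrame s R u h φ) (T : Finset (Fin 3))
    (hJ : (stalkIdeal C s.pt).map φ =
      ((Ideal.span (u '' ↑T)).map (Polynomial.C : R →+* R[X]) ⊔ Ideal.span {X}).map (Ideal.Quotient.mk (Ideal.span {h})))
    (hcoT : ∀ i ∈ Finset.Icc 1 h.natDegree, h.coeff (h.natDegree - i) ∈ Ideal.span (u '' ↑T) ^ i) :
    ∃ (R' : Type) (_ : CommRing R') (_ : IsLocalRing R') (u' : Fin 3 → R') (h' : R'[X])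
      (φ' : ((blowup C).presheaf.stalk x' : Type) →+* R'[X] ⧸ Ideal.span {h'}),
      IsCPFrame ⟨blowup C, hln', s.L.next (Scheme.hsStratum s.W 3 ν) C, P', x'⟩ R' u' h' φ' ∧
        IsAdicComplete (maximalIdeal R') R' ∧ h'.natDegree = h.natDegree ∧
      ∀ i < h'.natDegree, h'.coeff i ∈ maximalIdeal R' ^ (h'.natDegree - i) := by
  classical
  obtain ⟨hR, -, -, hu, -⟩ := (id hF)
  haveI := hR
  -- enumerate `T` and its complement
  set z : Fin T.card → R := u ∘ (fun i => T.orderEmbOfFin rfl i) with hz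
  set y : Fin Tᶜ.card → R := u ∘ (fun i => Tᶜ.orderEmbOfFin rfl i) with hy
  have hzr : Set.range z = u '' ↑T := by
    rw [hz, Set.range_comp]
    exact congrArg _ (Finset.range_orderEmbOfFin T rfl)
  have hyr : Set.range y = u '' ↑Tᶜ := by
    rw [hy, Set.range_comp]
    exact congrArg _ (Finset.range_orderEmbOfFin Tᶜ rfl)
  have hdl : T.card + Tᶜ.card = 3 := by rw [Finset.card_add_card_compl, Fintype.card_fin]
  have hzy : Ideal.span (Set.range (Fin.append z y)) = maximalIdeal R := by
    rw [range_fin_append, hzr, hyr, ← Set.image_union, ← Finset.coe_union, Finset.union_compl, Finset.coe_univ,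
      Set.image_univ, hu]
  have hJ' : (stalkIdeal C s.pt).map φ =
      ((Ideal.span (Set.range z)).map (Polynomial.C : R →+* R[X]) ⊔ Ideal.span {X}).map (Ideal.Quotient.mk (Ideal.span {h})) := by
    rw [hzr]; exact hJ
  have hcoJ : ∀ i < h.natDegree, h.coeff i ∈ Ideal.span (Set.range z) ^ (h.natDegree - i) := by
    intro i hi
    rw [hzr]
    have h1 := hcoT (h.natDegree - i) (Finset.mem_Icc.mpr ⟨by omega, by omega⟩)
    rwa [show h.natDegree - (h.natDegree - i) = i by omega] at h1
  letI : IsLocalRing R := inferInstance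
  exact hF.exists_isCPFrame_blowup_of_map_stalkIdeal_eq hRf hRa hX hs C P' hln' x' hcs hx' hcl hstr hdl z y hzy hJ' hcoJ

/-- [OURS · L1 W4.2] **D18 (i) along the chain: CP frames with `δ ≥ 1` over complete bases at every reached stage, modulo the adapted legal reading
of the canonical centres.** See the module docstring. [cite: CossartPiltant2019, Prop. 2.7 (arXiv v1 p. 14)]
[cite: CossartJannsenSaito2020, Thm. 2.3 and §2.2] -/
theorem exists_isCPFrame_of_reaches {p : ℕ} {R₀ : ∀ S : Scheme.{0}, CentreSeq S → Prop}
    (hRf : OracleFunctional R₀) (hRa : OracleAdmissible R₀) {ν : ℕ → ℕ} {X₀ : Scheme.{0}} [IsLocallyNoetherian X₀] {x : X₀}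
    (hX : IsMaximalOrigin p 3 ν X₀ x)
    (hread : ∀ s : MarkedStage.{0}, Reaches R₀ 3 ν (MarkedStage.init X₀ x) s →
      ∀ (C : s.W.IdealSheafData) (P' : Option (Pending (blowup C))), IsCanonicalStep R₀ 3 ν s.L s.P C P' →
      (∃ (R : Type) (_ : CommRing R) (_ : IsLocalRing R) (u : Fin 3 → R) (h : R[X])
        (φ : (s.W.presheaf.stalk s.pt : Type) →+* R[X] ⧸ Ideal.span {h}),
        IsCPFrame s R u h φ ∧ IsAdicComplete (maximalIdeal R) R ∧ ∀ i < h.natDegree, h.coeff i ∈ maximalIdeal R ^ (h.natDegree - i)) →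
      ∃ (R₁ : Type) (_ : CommRing R₁) (u₁ : Fin 3 → R₁) (h₁ : R₁[X])
        (φ₁ : (s.W.presheaf.stalk s.pt : Type) →+* R₁[X] ⧸ Ideal.span {h₁}) (T : Finset (Fin 3)),
        IsCPFrame s R₁ u₁ h₁ φ₁ ∧
        (stalkIdeal C s.pt).map φ₁ =
          ((Ideal.span (u₁ '' ↑T)).map (Polynomial.C : R₁ →+* R₁[X]) ⊔ Ideal.span {X}).map (Ideal.Quotient.mk (Ideal.span {h₁})) ∧
        ∀ i ∈ Finset.Icc 1 h₁.natDegree, h₁.coeff (h₁.natDegree - i) ∈ Ideal.span (u₁ '' ↑T) ^ i)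
    (h0 : ∃ (R : Type) (_ : CommRing R) (_ : IsLocalRing R) (u : Fin 3 → R) (h : R[X])
      (φ : ((MarkedStage.init X₀ x).W.presheaf.stalk (MarkedStage.init X₀ x).pt : Type) →+* R[X] ⧸ Ideal.span {h}),
      IsCPFrame (MarkedStage.init X₀ x) R u h φ ∧ IsAdicComplete (maximalIdeal R) R ∧
      ∀ i < h.natDegree, h.coeff i ∈ maximalIdeal R ^ (h.natDegree - i))
    {s : MarkedStage.{0}} (hs : Reaches R₀ 3 ν (MarkedStage.init X₀ x) s) :
    ∃ (R : Type) (_ : CommRing R) (_ : IsLocalRing R) (u : Fin 3 → R) (h : R[X])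
      (φ : (s.W.presheaf.stalk s.pt : Type) →+* R[X] ⧸ Ideal.span {h}),
      IsCPFrame s R u h φ ∧ IsAdicComplete (maximalIdeal R) R ∧
      ∀ i < h.natDegree, h.coeff i ∈ maximalIdeal R ^ (h.natDegree - i) := by
  induction hs with
  | refl => exact h0
  | tail hs' hstep ih =>
    have hstep' := hstep
    obtain ⟨C, P', hln', x', hcs, hx', hcl, hstr, rfl⟩ := hstep'
    obtain ⟨R₁, _, u₁, h₁, φ₁, T, hF₁, hJ, hcoT⟩ := hread _ hs' C P' hcs ih
    obtain ⟨R', _, _, u', h', φ', hF', hcpl', -, hco'⟩ :=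
      hF₁.exists_isCPFrame_blowup_of_map_stalkIdeal_eq_finset hRf hRa hX hs' C P' hln' x' hcs hx' hcl hstr T hJ hcoT
    exact ⟨R', inferInstance, inferInstance, u', h', φ', hF', hcpl', hco'⟩

end Summit.ResolutionOfSingularities.ResolutionOfSingularities.Theorems.SigmaMaxModificationsCorridor3.Moving

end
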